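import Mathlib
import Summits.NavierStokesRegularity.NavierStokesRegularity.Theorems.TypeIQuarterGateScarEnvelopeTypeISatelliteTowerUniformFloor
import Summits.NavierStokesRegularity.NavierStokesRegularity.Theorems.TypeIQuarterGateScarEnvelopeTypeISatelliteTowerGlobalClosure
import Summits.NavierStokesRegularity.NavierStokesRegularity.Theorems.TypeIQuarterGateScarEnvelopeTypeISatelliteTowerClosure
import Summits.NavierStokesRegularity.NavierStokesRegularity.Theorems.TypeIQuarterGateScarEnvelopeTypeISatelliteTowerExclusions
import Summits.NavierStokesRegularity.NavierStokesRegularity.Theorems.TypeIQuarterGateScarEnvelopeTypeISatelliteTowerCensus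
import Summits.NavierStokesRegularity.NavierStokesRegularity.Theorems.TypeIQuarterGateScarEnvelopeTypeISatelliteTowerRooted
import Summits.NavierStokesRegularity.NavierStokesRegularity.Theorems.TypeIQuarterGateScarEnvelopeTypeISatelliteTowerRateMinimal

/-!
# Satellite tower for crux `ScarEnvelopeTypeI` (stmt-NavierStokesRegularity-23843) — Part R1–R4: THE CRITICAL SCAR RATE `M_c`; class-independence of `m_*`; critical rigidity

Part R1–R4 of nsreg-p3's ROUND-38 artefact (section `CriticalRate`): R1 `ABTower.mono`, `singRates_mono`, `minSingRate_antitone`;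
R2 ★ `ABTower.reclass` (re-classing through the tangent flow: class `tightRate U y'`), `ABTower.exists_rootObj_tightRate`;
R3 `scarClasses`, `critRate` (= `M_c := sInf {M | (singRates M).Nonempty}`), ★★ `minSingRate_eq_critRate` (m_*(M) = M_c for every
scar-carrying class), `epsL_le_critRate`, `ABTower.regPt_of_lt_critRate`, `singRates_nonempty_of_critRate_lt`; R4 `CritAttained`,
★ `ABTower.tightRate_eq_critRate` (critical rigidity), ★★ `minSingRateAttained_iff` / `minSingRateAttained_all_or_none`,
`critAttained_iff_exists_rootObj`, `RootObj.exactMin_of_critRate`, `RootObj.equiRated_of_critRate`, `ABTower.exists_rootObj_critRate`.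

PROVENANCE: declaration texts VERBATIM from the HOME artefact of the instrument seat nsreg-p3 g27 (cell `pub/ns-regularity-ideate`):
`round-38/CritRate38.lean` (sha16 `30eed4aabab5065a`, a standalone module written against the TREE; memo `round-38/ROUND-38.md`
4eff55037f29b2fe), scored by referee ref3 g27 (`SCORE-p3-ROUND-38-0828.md`); the author cannot write under `Theorems/`
(`perm.theorems-prover-only`); landed by the prover ns-es-p1 g5 as landing hand of record (director-ns DIRECTOR-NS #237 (3)), split into
≤ 400-line modules, `E3` spelled out, the artefact's `#guard_msgs … #print axioms` certificates not landed.
`--supports stmt-NavierStokesRegularity-23843 --as helper`.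

HONEST FRAMING: instrument theorems about HYPOTHETICAL Type-I zoom limits (Albritton–Barker objects of the census of crux
`TypeIQuarterGate.ScarEnvelopeTypeI`, item 23843); the analytic input is the tree's closure engine (compactness
`local_typeI_compactness_twin_inBall`, sharpened to constant 1 in Part S1; Q1 whole-space), P1 rate inheritance, L8 persistence and the
tree's PROVED small-constant Liouville theorem; Parts R/S are order theory on the re-classing and closure lemmas.  NOTHING OPEN IS
PROVED: 23843, (L′) `TypeILiouvilleAB` / (L′₀), the GLOBAL (S∞) = `CritAttained`, (M𝐈₁), (E1⁺), (E2ᵣ), route ExtremalTypeIConstant's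
cruxes, N0 and Navier–Stokes regularity are OPEN; `critRate`, `levelCrit I`, `liouvilleRate` are `sInf`s that are `0` by junk value
when the defining set is empty (every statement using them carries the nonemptiness hypothesis explicitly).
-/

-- the summit-side namespace repeats a component by design (single-conjunct summit, D-0017)
set_option linter.dupNamespace false

open MeasureTheory Set Metric Filter Topology
open scoped ENNReal NNReal InnerProductSpace
open Literature.Analysis.FluidPDE

namespace Summit.NavierStokesRegularity.NavierStokesRegularity.Cruxes.ScarEnvelopeTypeI.ZoomDictionary

section CriticalRate

variable {U : ℝ → (EuclideanSpace ℝ (Fin 3)) → (EuclideanSpace ℝ (Fin 3))} {P : ℝ → (EuclideanSpace ℝ (Fin 3)) → ℝ}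

/-! ### R1. The class grows with the constant -/

/-- An A–B object of class `M` is an A–B object of every class `M' ≥ M`. -/
theorem ABTower.mono {M M' : ℝ} {H : ℝ → (EuclideanSpace ℝ (Fin 3)) → (EuclideanSpace ℝ (Fin 3)) →L[ℝ] (EuclideanSpace ℝ (Fin 3))} (h : ABTower M U P H) (hM : M ≤ M') :
    ABTower M' U P H := by
  obtain ⟨⟨hc, hdiv, hmild, hdec⟩, hIB, hH, hI⟩ := h
  refine ⟨⟨hc, hdiv, hmild, fun t ht x => (hdec t ht x).trans ?_⟩, hIB, hH, hI⟩
  exact div_le_div_of_nonneg_right hM (Real.sqrt_nonneg _)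

/-- The realised scar rates grow with the class. -/
theorem singRates_mono {M M' : ℝ} (hM : M ≤ M') : singRates M ⊆ singRates M' := by
  rintro r ⟨U, P, H, y, hAB, hy, hr⟩
  exact ⟨U, P, H, y, hAB.mono hM, hy, hr⟩

/-- `m_*` is antitone in the class constant (on scar-carrying classes). -/
theorem minSingRate_antitone {M M' : ℝ} (hM : M ≤ M') (hne : (singRates M).Nonempty) :
    minSingRate M' ≤ minSingRate M :=
  csInf_le_csInf (singRates_bddBelow M') hne (singRates_mono hM)

/-! ### R2. RE-CLASSING through the tangent flow -/

/-- ★ **Re-classing through the tangent flow.**  At a final-time point `y'` of an A–B object of ANY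
class `M`, the A–B representative of a tangent flow (Q1) is an A–B object of class `tightRate U y'` —
its GLOBAL Type-I constant is the LOCAL tight rate of the point zoomed at (P1 rate inheritance on every
`Q_R(0)` for every constant above the tight rate, then the infimum) — and it is singular at the origin
if `y'` is singular (persistence L8 + the a.e. identification on `Q_R(0)`, `R < 1`). -/
theorem ABTower.reclass {M : ℝ} {H : ℝ → (EuclideanSpace ℝ (Fin 3)) → (EuclideanSpace ℝ (Fin 3)) →L[ℝ] (EuclideanSpace ℝ (Fin 3))} (hT : ABTower M U P H) (y' : (EuclideanSpace ℝ (Fin 3))) :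
    ∃ (U' : ℝ → (EuclideanSpace ℝ (Fin 3)) → (EuclideanSpace ℝ (Fin 3))) (P' : ℝ → (EuclideanSpace ℝ (Fin 3)) → ℝ) (H' : ℝ → (EuclideanSpace ℝ (Fin 3)) → (EuclideanSpace ℝ (Fin 3)) →L[ℝ] (EuclideanSpace ℝ (Fin 3))),
      ABTower (tightRate U y') U' P' H' ∧ (¬ RegPt U y' → ¬ RegPt U' 0) := by
  have hTO : TowerObj M U P := towerObj_of_abTower hT
  obtain ⟨L, Ū, hŪ⟩ := exists_tangentU_of_towerObj hTO y'
  obtain ⟨U', P', H', σ, hσ, hT', hid, -, hconv'⟩ := abTower_closed_global hT hŪ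
  have hLpos : ∀ k, 0 < L (σ k) := fun k => hŪ.1 (σ k)
  have hL0 : Tendsto (fun k => L (σ k)) atTop (𝓝 0) := hŪ.2.1.comp hσ.tendsto_atTop
  have hcU : ContinuousOn (Function.uncurry U) (Iio 0 ×ˢ univ) := hT.1.1.continuousOn
  have hcU' : ContinuousOn (Function.uncurry U') (Iio 0 ×ˢ univ) := hT'.1.1.continuousOn
  -- every constant above the tight rate of `y'` is a rate of `U'` on every `Q_R(0)`
  have hall : ∀ m : ℝ, tightRate U y' < m → ∀ R : ℝ, 0 < R → ∀ t ∈ Ioo (-(R ^ 2)) 0,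
      ∀ x ∈ ball (0 : (EuclideanSpace ℝ (Fin 3))) R, Real.sqrt (-t) * ‖U' t x‖ ≤ m := by
    intro m hm R hR
    obtain ⟨δ, hδ, hrate⟩ := hTO.rateAt_of_tightRate_lt hm
    have hmeasU' : AEStronglyMeasurable (Function.uncurry U')
        (volume.restrict (parabolicCylinder R (0 : ℝ × (EuclideanSpace ℝ (Fin 3))))) :=
      (hcU'.mono (parabolicCylinder_subset_lowerHalf R (0 : (EuclideanSpace ℝ (Fin 3))))).aestronglyMeasurable
        (isOpen_parabolicCylinder R _).measurableSet
    exact rate_everywhere_of_ae hcU' (rate_of_zooms hcU hLpos hL0 hR hmeasU' (hconv' R hR) hδ hrate)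
  -- hence the tight rate itself is a rate of `U'` everywhere
  have hall' : ∀ R : ℝ, 0 < R → ∀ t ∈ Ioo (-(R ^ 2)) 0, ∀ x ∈ ball (0 : (EuclideanSpace ℝ (Fin 3))) R,
      Real.sqrt (-t) * ‖U' t x‖ ≤ tightRate U y' := fun R hR t ht x hx =>
    le_of_forall_gt_imp_ge_of_dense fun m hm => hall m hm R hR t ht x hx
  have hdec : HasTypeITimeDecay (tightRate U y') U' := hasTypeITimeDecay_of_rates hall'
  refine ⟨U', P', H', ⟨⟨hT'.1.1, hT'.1.2.1, hT'.1.2.2.1, hdec⟩, hT'.2.1, hT'.2.2.1, hT'.2.2.2⟩,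
    fun hy hr => ?_⟩
  exact hTO.not_regPt_tangentU_zero hy hŪ ((regPt_iff_of_ae_eq_of_norm_lt_one hid (by simp)).2 hr)

/-- Re-classing at a SCAR: a scar of tight rate `m` (in any class) yields a ROOT OBJECT of class `m`. -/
theorem ABTower.exists_rootObj_tightRate {M : ℝ} {H : ℝ → (EuclideanSpace ℝ (Fin 3)) → (EuclideanSpace ℝ (Fin 3)) →L[ℝ] (EuclideanSpace ℝ (Fin 3))} (hT : ABTower M U P H)
    {y' : (EuclideanSpace ℝ (Fin 3))} (hy : ¬ RegPt U y') : ∃ n : TNode, RootObj (tightRate U y') n := by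
  obtain ⟨U', P', H', hAB', h0⟩ := hT.reclass y'
  exact ⟨⟨U', P', H', 0⟩, hAB', h0 hy⟩

/-! ### R3. The CRITICAL SCAR RATE `M_c` and the class-independence of `m_*` -/

/-- The Type-I constants whose A–B class carries a final-time scar. -/
def scarClasses : Set ℝ := {M | (singRates M).Nonempty}

/-- ★ The **CRITICAL SCAR RATE** `M_c`: the infimum of the Type-I constants whose A–B class carries a
final-time scar (`= 0` by junk value if no class does). -/
noncomputable def critRate : ℝ := sInf scarClasses

/-- `scarClasses` is bounded below (by `0`). -/
theorem scarClasses_bddBelow : BddBelow scarClasses :=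
  ⟨0, fun _ ⟨_, _, _, _, y, hAB, _, _⟩ =>
    (tightRate_nonneg (towerObj_of_abTower hAB) y).trans ((towerObj_of_abTower hAB).tightRate_le y)⟩

/-- `scarClasses` is an upper set: a class above a scar-carrying class carries a scar. -/
theorem scarClasses_mono {M M' : ℝ} (hM : M ≤ M') (h : M ∈ scarClasses) : M' ∈ scarClasses :=
  Set.Nonempty.mono (singRates_mono hM) h

/-- A realised scar rate is itself a scar-carrying class constant (re-classing). -/
theorem tightRate_mem_scarClasses {M : ℝ} {H : ℝ → (EuclideanSpace ℝ (Fin 3)) → (EuclideanSpace ℝ (Fin 3)) →L[ℝ] (EuclideanSpace ℝ (Fin 3))} (hT : ABTower M U P H)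
    {y : (EuclideanSpace ℝ (Fin 3))} (hy : ¬ RegPt U y) : tightRate U y ∈ scarClasses := by
  obtain ⟨n, hn⟩ := hT.exists_rootObj_tightRate hy
  exact ⟨_, n.U, n.P, n.H, 0, hn.1, hn.2, rfl⟩

/-- `M_c ≤ M` for every scar-carrying class `M`. -/
theorem critRate_le_of_nonempty {M : ℝ} (hne : (singRates M).Nonempty) : critRate ≤ M :=
  csInf_le scarClasses_bddBelow hne

/-- ★ Every realised scar rate, in ANY class, bounds the critical rate from above. -/
theorem critRate_le_of_mem {M r : ℝ} (hr : r ∈ singRates M) : critRate ≤ r := by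
  obtain ⟨U, P, H, y, hAB, hy, rfl⟩ := hr
  exact csInf_le scarClasses_bddBelow (tightRate_mem_scarClasses hAB hy)

/-- `M_c ≤ tightRate U y` at every singular final-time point of an A–B object. -/
theorem critRate_le_tightRate {M : ℝ} {H : ℝ → (EuclideanSpace ℝ (Fin 3)) → (EuclideanSpace ℝ (Fin 3)) →L[ℝ] (EuclideanSpace ℝ (Fin 3))} (hT : ABTower M U P H)
    {y : (EuclideanSpace ℝ (Fin 3))} (hy : ¬ RegPt U y) : critRate ≤ tightRate U y :=
  critRate_le_of_mem ⟨U, P, H, y, hT, hy, rfl⟩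

/-- `M_c ≤ m_*(M)` for every scar-carrying class `M`. -/
theorem critRate_le_minSingRate {M : ℝ} (hne : (singRates M).Nonempty) : critRate ≤ minSingRate M :=
  le_csInf hne fun _ hr => critRate_le_of_mem hr

/-- `m_*(M) ≤ M_c` for every scar-carrying class `M` (re-classing + monotonicity). -/
theorem minSingRate_le_critRate {M : ℝ} (hne : (singRates M).Nonempty) : minSingRate M ≤ critRate :=
  le_csInf ⟨M, hne⟩ fun μ hμ => by
    rcases le_or_gt μ M with h | h
    · exact (minSingRate_antitone h hμ).trans (minSingRate_le_of_nonempty hμ)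
    · exact (minSingRate_le_of_nonempty hne).trans h.le

/-- ★★ **THE CLASS-WIDE MINIMAL SCAR RATE DOES NOT DEPEND ON THE CLASS**: `m_*(M) = M_c` for every
class carrying a final-time scar. -/
theorem minSingRate_eq_critRate {M : ℝ} (hne : (singRates M).Nonempty) : minSingRate M = critRate :=
  le_antisymm (minSingRate_le_critRate hne) (critRate_le_minSingRate hne)

/-- `m_*` takes the same value on any two scar-carrying classes. -/
theorem minSingRate_eq_minSingRate {M M' : ℝ} (hne : (singRates M).Nonempty)
    (hne' : (singRates M').Nonempty) : minSingRate M = minSingRate M' := by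
  rw [minSingRate_eq_critRate hne, minSingRate_eq_critRate hne']

/-- `0 ≤ M_c`. -/
theorem critRate_nonneg : 0 ≤ critRate :=
  Real.sInf_nonneg fun _ ⟨_, _, _, _, y, hAB, _, _⟩ =>
    (tightRate_nonneg (towerObj_of_abTower hAB) y).trans ((towerObj_of_abTower hAB).tightRate_le y)

/-- ★ **The uniform floor, class-free form**: `ε_L ≤ M_c` as soon as some class carries a scar (Q3d). -/
theorem epsL_le_critRate (h : scarClasses.Nonempty) : epsL ≤ critRate := by
  obtain ⟨M, hne⟩ := h
  rw [← minSingRate_eq_critRate hne]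
  exact epsL_le_minSingRate' hne

/-- `0 < M_c` as soon as some class carries a scar. -/
theorem critRate_pos (h : scarClasses.Nonempty) : 0 < critRate :=
  epsL_pos.trans_le (epsL_le_critRate h)

/-- Below the critical rate NO class carries a scar. -/
theorem singRates_eq_empty_of_lt_critRate {M : ℝ} (hM : M < critRate) : singRates M = ∅ :=
  Set.not_nonempty_iff_eq_empty.1 fun hne => absurd hM (not_lt.2 (critRate_le_of_nonempty hne))

/-- **Regularity below the critical rate**: every final-time point of every A–B object of a class
`M < M_c` is regular. -/
theorem ABTower.regPt_of_lt_critRate {M : ℝ} {H : ℝ → (EuclideanSpace ℝ (Fin 3)) → (EuclideanSpace ℝ (Fin 3)) →L[ℝ] (EuclideanSpace ℝ (Fin 3))} (hT : ABTower M U P H)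
    (hM : M < critRate) (y : (EuclideanSpace ℝ (Fin 3))) : RegPt U y := by
  by_contra hy
  have h : tightRate U y ∈ singRates M := ⟨U, P, H, y, hT, hy, rfl⟩
  rw [singRates_eq_empty_of_lt_critRate hM] at h
  simp at h

/-- Above the critical rate EVERY class carries a scar (as soon as one class does). -/
theorem singRates_nonempty_of_critRate_lt (h : scarClasses.Nonempty) {M : ℝ} (hM : critRate < M) :
    (singRates M).Nonempty := by
  obtain ⟨μ, hμ, hμM⟩ := (csInf_lt_iff scarClasses_bddBelow h).1 hM
  exact scarClasses_mono hμM.le hμ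

/-- The scar-carrying classes form the ray above `M_c` (open or closed at `M_c`: that is (S∞)). -/
theorem mem_scarClasses_iff_of_ne (h : scarClasses.Nonempty) {M : ℝ} (hM : M ≠ critRate) :
    M ∈ scarClasses ↔ critRate < M := by
  refine ⟨fun hm => lt_of_le_of_ne (critRate_le_of_nonempty hm) hM.symm,
    fun hm => singRates_nonempty_of_critRate_lt h hm⟩

/-! ### R4. (S∞) is ONE class-free statement; CRITICAL RIGIDITY -/

/-- **CRIT** — the critical class itself carries a final-time scar (the infimum `M_c` is a minimum).
OPEN (it is (S∞), see `minSingRateAttained_iff`). -/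
def CritAttained : Prop := (singRates critRate).Nonempty

/-- ★ **CRITICAL RIGIDITY.**  In the critical class EVERY scar of EVERY object has tight rate EXACTLY
`M_c` (`≤`: the class constant bounds every tight rate; `≥`: `m_*(M_c) = M_c`). -/
theorem ABTower.tightRate_eq_critRate {H : ℝ → (EuclideanSpace ℝ (Fin 3)) → (EuclideanSpace ℝ (Fin 3)) →L[ℝ] (EuclideanSpace ℝ (Fin 3))} (hT : ABTower critRate U P H)
    {y : (EuclideanSpace ℝ (Fin 3))} (hy : ¬ RegPt U y) : tightRate U y = critRate :=
  le_antisymm ((towerObj_of_abTower hT).tightRate_le y) (critRate_le_tightRate hT hy)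

/-- ★★ **(S∞) IS CLASS-INDEPENDENT.**  For every class carrying a scar: the class-wide minimal scar
rate is ATTAINED in the class iff the critical class carries a scar. (`→`: re-class the attaining
scar, whose tight rate is `m_*(M) = M_c`; `←`: a critical scar has tight rate `M_c = m_*(M)` and lies in
every class `M ≥ M_c`.) -/
theorem minSingRateAttained_iff {M : ℝ} (hne : (singRates M).Nonempty) :
    MinSingRateAttained M ↔ CritAttained := by
  constructor
  · intro h
    obtain ⟨U, P, H, y, hAB, hy, hr⟩ := (h : minSingRate M ∈ singRates M)
    obtain ⟨n, hn⟩ := hAB.exists_rootObj_tightRate hy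
    rw [← hr, minSingRate_eq_critRate hne] at hn
    exact ⟨_, n.U, n.P, n.H, 0, hn.1, hn.2, rfl⟩
  · rintro ⟨r, U, P, H, y, hAB, hy, -⟩
    show minSingRate M ∈ singRates M
    rw [minSingRate_eq_critRate hne]
    exact ⟨U, P, H, y, hAB.mono (critRate_le_of_nonempty hne), hy, (hAB.tightRate_eq_critRate hy).symm⟩

/-- Hence (S∞) holds in ALL scar-carrying classes or in NONE of them. -/
theorem minSingRateAttained_all_or_none :
    (∀ M : ℝ, (singRates M).Nonempty → MinSingRateAttained M) ∨ ∀ M : ℝ, ¬ MinSingRateAttained M := by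
  by_cases h : CritAttained
  · exact Or.inl fun M hne => (minSingRateAttained_iff hne).2 h
  · exact Or.inr fun M hM => h ((minSingRateAttained_iff ⟨_, hM⟩).1 hM)

/-- `CritAttained` ⟺ the critical class has a ROOT object (re-classing moves the scar to the origin). -/
theorem critAttained_iff_exists_rootObj : CritAttained ↔ ∃ n : TNode, RootObj critRate n := by
  constructor
  · rintro ⟨r, U, P, H, y, hAB, hy, -⟩
    obtain ⟨n, hn⟩ := hAB.exists_rootObj_tightRate hy
    rw [hAB.tightRate_eq_critRate hy] at hn
    exact ⟨n, hn⟩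
  · rintro ⟨n, hAB, h0⟩
    exact ⟨_, n.U, n.P, n.H, 0, hAB, h0, rfl⟩

/-- In the critical class every root object is an EXACT MINIMISER (ROUND-34's `ExactMin`, there
conditional on (S∞)). -/
theorem RootObj.exactMin_of_critRate {n : TNode} (h : RootObj critRate n) : ExactMin critRate n :=
  ⟨h.1, h.2, by
    rw [h.1.tightRate_eq_critRate h.2,
      minSingRate_eq_critRate ⟨_, n.U, n.P, n.H, 0, h.1, h.2, rfl⟩]⟩

/-- In the critical class every root object is EQUI-RATED at level `(M_c, η)` for every `η ≥ 0` —
including `η = 0`: local rate `≤ M_c` at EVERY point, tight rate `= M_c` at every scar. -/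
theorem RootObj.equiRated_of_critRate {n : TNode} (h : RootObj critRate n) {η : ℝ} (hη : 0 ≤ η) :
    EquiRated critRate critRate η n :=
  ⟨h.1, h.2, fun y _ => (rateAt_of_hasTypeITimeDecay h.1.1.2.2.2 y).mono (le_add_of_nonneg_right hη),
    fun _ hy => (h.1.tightRate_eq_critRate hy).ge⟩

/-- The critical class is CLOSED UNDER DESCENT AT SCARS: re-classing a critical scar gives a critical
root object again (class `tightRate = M_c`). -/
theorem ABTower.exists_rootObj_critRate {H : ℝ → (EuclideanSpace ℝ (Fin 3)) → (EuclideanSpace ℝ (Fin 3)) →L[ℝ] (EuclideanSpace ℝ (Fin 3))} (hT : ABTower critRate U P H)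
    {y : (EuclideanSpace ℝ (Fin 3))} (hy : ¬ RegPt U y) : ∃ n : TNode, RootObj critRate n := by
  obtain ⟨n, hn⟩ := hT.exists_rootObj_tightRate hy
  rw [hT.tightRate_eq_critRate hy] at hn
  exact ⟨n, hn⟩

end CriticalRate

end Summit.NavierStokesRegularity.NavierStokesRegularity.Cruxes.ScarEnvelopeTypeI.ZoomDictionary
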